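import Literature.NumberTheory.LFunctions.SmoothedExplicitFormulaContour
import HarnessLib

/-!
# The contour integral of `−(f'/f)·Φ` around a rectangle: the residues at the zeros of `f`

Topic `Literature/NumberTheory/LFunctions` (support for explicit formulae), namespace `Literature.NumberTheory.LFunctions.EntireEF`.
Everything here is PROVED (theorems only; no named facts).

For an entire `f`, not identically zero, an entire weight `Φ` and a rectangle
`R = [a, b] × [−T, T]` with no zero of `f` on `∂R`:

  `∮_{∂R} (−f'/f)(w) Φ(w) dw = −2πi Σ_{ρ ∈ R, f(ρ) = 0} m(ρ) Φ(ρ)`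

(`rectBoundaryIntegral_neg_logDeriv_mul_eq`), where `m(ρ) = analyticOrderNatAt f ρ` (the poles of a
logarithmic derivative are simple whatever the multiplicity). This is the residue step of every
smoothed explicit formula for an entire `L`-function with an entire test transform (e.g. the
Thorner–Zaman weight, whose Laplace transform is entire because `f(0) = 0`), from the tree's residue
theorem for finitely many simple poles
(`Literature.Analysis.Complex.rectBoundaryIntegral_eq_sum_of_simplePoles`) and the local form
`f'/f = m/(w − ρ) + B` (`Literature.NumberTheory.LFunctions.exists_analyticAt_logDeriv_eq_add`).

Also: `finite_zeros_of_entire` — the zeros of such an `f` in a compact set form a finite set.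

## References

* J. B. Conway, *Functions of One Complex Variable I*, Ch. V Thm. 2.2 (residue theorem). [Conway1978]
* K. Ford, *Zero-free regions for the Riemann zeta function* (2002), Lemma 4.5 (proof). [Ford2002Millennium]
-/

noncomputable section

open Complex Set MeasureTheory Filter Topology

namespace Literature.NumberTheory.LFunctions.EntireEF

open Literature.Analysis.Complex

/-- The zeros of an entire function that does not vanish identically, in a compact set, are finite. [folklore] -/
theorem finite_zeros_of_entire {f : ℂ → ℂ} (hf : Differentiable ℂ f) {c : ℂ} (hc : f c ≠ 0)
    {S : Set ℂ} (hS : IsCompact S) : (S ∩ f ⁻¹' {0}).Finite := by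
  have han : AnalyticOnNhd ℂ f univ := hf.differentiableOn.analyticOnNhd isOpen_univ
  have hcod := han.preimage_zero_mem_codiscreteWithin (x := c) hc (mem_univ _) isConnected_univ
  have hclosed : IsClosed (f ⁻¹' {0}) := by simpa using (mem_codiscrete'.mp hcod).1
  have hdisc : IsDiscrete (f ⁻¹' {0}) := by simpa using (mem_codiscrete'.mp hcod).2
  exact (hS.inter_right hclosed).finite (hdisc.mono inter_subset_right)

/-- For an entire `f` with `f(c) ≠ 0`, no order is infinite. [folklore] -/
theorem analyticOrderAt_ne_top_of_entire {f : ℂ → ℂ} (hf : Differentiable ℂ f) {c : ℂ} (hc : f c ≠ 0) (u : ℂ) :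
    analyticOrderAt f u ≠ ⊤ := by
  have han : AnalyticOnNhd ℂ f univ := hf.differentiableOn.analyticOnNhd isOpen_univ
  intro htop
  have hzero := AnalyticOnNhd.eqOn_zero_of_preconnected_of_eventuallyEq_zero han isPreconnected_univ
    (mem_univ u) (analyticOrderAt_eq_top.1 htop)
  exact hc (hzero (mem_univ c))

/-- The finite set of zeros of `f` in the closed rectangle `[a, b] × [−T, T]`. [folklore] -/
def rectZeros {f : ℂ → ℂ} (hf : Differentiable ℂ f) {c : ℂ} (hc : f c ≠ 0) (a b T : ℝ) : Finset ℂ :=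
  (finite_zeros_of_entire hf hc ((isCompact_Icc (a := a) (b := b)).reProdIm (isCompact_Icc (a := -T) (b := T)))).toFinset

/-- Membership in `rectZeros`. [folklore] -/
theorem mem_rectZeros {f : ℂ → ℂ} (hf : Differentiable ℂ f) {c : ℂ} (hc : f c ≠ 0) {a b T : ℝ} {ρ : ℂ} :
    ρ ∈ rectZeros hf hc a b T ↔ (ρ.re ∈ Icc a b ∧ ρ.im ∈ Icc (-T) T) ∧ f ρ = 0 := by
  rw [rectZeros, Set.Finite.mem_toFinset, mem_inter_iff, Complex.mem_reProdIm, mem_preimage, mem_singleton_iff]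

/-- **The residues of `−(f'/f) Φ` at the zeros of `f` in a rectangle.** Let `f` be entire with
`f(c) ≠ 0`, `Φ` entire, `a < b`, `0 < T`, and suppose no zero of `f` lies on the boundary of
`R = [a, b] × [−T, T]`. Then `∮_{∂R} (−f'/f) Φ = 2πi Σ_{ρ ∈ R, f(ρ)=0} (−m(ρ)) Φ(ρ)` (four-term
convention of Mathlib; `m = analyticOrderNatAt f`). [cite: Conway1978, Ch. V Thm. 2.2] -/
theorem rectBoundaryIntegral_neg_logDeriv_mul_eq {f Φ : ℂ → ℂ} (hf : Differentiable ℂ f) {c : ℂ} (hc : f c ≠ 0)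
    (hΦ : Differentiable ℂ Φ) {a b T : ℝ} (hab : a < b) (hT : 0 < T)
    (hbdry : ∀ ρ : ℂ, f ρ = 0 → ρ.re ∈ Icc a b → ρ.im ∈ Icc (-T) T → ρ.re ∈ Ioo a b ∧ ρ.im ∈ Ioo (-T) T) :
    rectBoundaryIntegral (fun w ↦ -logDeriv f w * Φ w) a b (-T) T =
      2 * Real.pi * I * ∑ ρ ∈ rectZeros hf hc a b T, (-(analyticOrderNatAt f ρ : ℂ) * Φ ρ) := by
  classical
  have hcd : -T < T := by linarith
  have han : ∀ w, AnalyticAt ℂ f w := fun w ↦ hf.analyticAt w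
  set S : Finset ℂ := rectZeros hf hc a b T with hS
  have hSprop : ∀ ρ ∈ S, f ρ = 0 ∧ ρ.re ∈ Ioo a b ∧ ρ.im ∈ Ioo (-T) T := by
    intro ρ hρ
    obtain ⟨⟨hre, him⟩, h0⟩ := (mem_rectZeros hf hc).1 hρ
    exact ⟨h0, hbdry ρ h0 hre him⟩
  -- residues
  set r : ℂ → ℂ := fun p ↦ -(analyticOrderNatAt f p : ℂ) * Φ p with hr
  -- the open set: `f ≠ 0` together with the poles
  set U : Set ℂ := {w : ℂ | f w ≠ 0} ∪ (S : Set ℂ) with hU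
  have hUopen : IsOpen U := by
    rw [isOpen_iff_mem_nhds]
    intro w hw
    by_cases hfw : f w = 0
    · have hwS : w ∈ (S : Set ℂ) := by
        rcases hw with h | h
        · exact absurd hfw h
        · exact h
      rcases (han w).eventually_eq_zero_or_eventually_ne_zero with h | h
      · exact absurd (analyticOrderAt_eq_top.2 h) (analyticOrderAt_ne_top_of_entire hf hc w)
      · rw [eventually_nhdsWithin_iff] at h
        filter_upwards [h] with z hz
        by_cases hzw : z = w
        · exact Or.inr (hzw ▸ hwS)
        · exact Or.inl (hz hzw)
    · exact mem_of_superset ((isOpen_ne_fun hf.continuous continuous_const).mem_nhds hfw) subset_union_left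
  have hKU : Icc a b ×ℂ Icc (-T) T ⊆ U := by
    intro w hw
    by_cases hfw : f w = 0
    · rw [Complex.mem_reProdIm] at hw
      exact Or.inr (Finset.mem_coe.2 ((mem_rectZeros hf hc).2 ⟨hw, hfw⟩))
    · exact Or.inl hfw
  have hSsub : (S : Set ℂ) ⊆ Ioo a b ×ℂ Ioo (-T) T := by
    intro p hp
    obtain ⟨-, hre, him⟩ := hSprop p (Finset.mem_coe.1 hp)
    exact ⟨hre, him⟩
  -- differentiability off the poles
  have hGd : DifferentiableOn ℂ (fun w ↦ -logDeriv f w * Φ w) (U \ (S : Set ℂ)) := by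
    intro w hw
    have hfw : f w ≠ 0 := by
      rcases hw.1 with h | h
      · exact h
      · exact absurd h hw.2
    have hld : DifferentiableAt ℂ (logDeriv f) w := ((han w).deriv.div (han w) hfw).differentiableAt
    exact (hld.neg.mul (hΦ w)).differentiableWithinAt
  have key := rectBoundaryIntegral_eq_sum_of_simplePoles hab hcd S (fun w ↦ -logDeriv f w * Φ w) r U hUopen hKU hSsub hGd ?poles
  case poles =>
    intro p hp
    obtain ⟨hfp, -, -⟩ := hSprop p hp
    obtain ⟨B, hB, hev⟩ := exists_analyticAt_logDeriv_eq_add (han p)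
      (analyticOrderAt_ne_top_of_entire hf hc p)
    set m : ℕ := analyticOrderNatAt f p with hm
    have hall : ∀ᶠ z in 𝓝 p, (z ≠ p → f z ≠ 0 ∧ deriv f z / f z = (m : ℂ) / (z - p) + B z) ∧ DifferentiableAt ℂ B z := by
      rw [eventually_nhdsWithin_iff] at hev
      filter_upwards [hev, hB.eventually_analyticAt] with z h1 h2
      exact ⟨h1, h2.differentiableAt⟩
    obtain ⟨V, hVsub, hVopen, hpV⟩ := mem_nhds_iff.1 hall
    refine ⟨fun z ↦ -B z * Φ z * (z - p) - (m : ℂ) * Φ z, V, hVopen.mem_nhds hpV, ?_, ?_, ?_⟩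
    · intro z hz
      obtain ⟨-, hBd⟩ := hVsub hz
      exact (((hBd.neg.mul (hΦ z)).mul (differentiableAt_id.sub_const p)).sub
        ((differentiableAt_const _).mul (hΦ z))).differentiableWithinAt
    · simp only [hr, sub_self, mul_zero, zero_sub, neg_mul, hm]
    · intro z hz hzp
      obtain ⟨h1, -⟩ := hVsub hz
      obtain ⟨hfz, hLdz⟩ := h1 hzp
      dsimp only
      rw [logDeriv_apply, hLdz]
      have h3 : z - p ≠ 0 := sub_ne_zero.2 hzp
      field_simp
      ring
  rw [key]

/-- The set `rectZeros` contains exactly the zeros: a version of the sum over any finset `Z` of zeros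
containing them all (convenient when the zeros are described otherwise). [folklore] -/
theorem sum_rectZeros_eq_of_subset {f : ℂ → ℂ} (hf : Differentiable ℂ f) {c : ℂ} (hc : f c ≠ 0) {a b T : ℝ}
    (g : ℂ → ℂ) {Z : Finset ℂ} (hZ : ∀ ρ, ρ ∈ Z ↔ (ρ.re ∈ Icc a b ∧ ρ.im ∈ Icc (-T) T) ∧ f ρ = 0) :
    ∑ ρ ∈ rectZeros hf hc a b T, g ρ = ∑ ρ ∈ Z, g ρ := by
  refine Finset.sum_congr ?_ fun _ _ ↦ rfl
  ext ρ
  rw [mem_rectZeros hf hc, hZ]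

end Literature.NumberTheory.LFunctions.EntireEF

end
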